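import Literature.AnabelianGeometry.EtaleTheta.SettingModelChiTwistedLatticeTheta
import HarnessLib

/-!
# The χ-twisted root model with an extra Tate lattice, file 1d: the SWAP automorphism of `Π^tp_X` and the
# non-characteristic `Π^tp_Ÿ` of `ThetaSetting.modelLat` (F-2633 closure certificate «F2633-SWAP-TOWER»)

Mochizuki, *The étale theta function …*, Publ. RIMS **45** (2009) [EtTh], §1 p. 17 ("`Ÿ := Ÿ₁ = Y₂`") and Cor. 2.18 (i)
p. 57 / [IUTchII] Prop. 1.4 p. 27 ("the open subgroup `Π_Ÿ(Π) ⊆ Π` corresponding to the tempered covering `Ÿ`")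
[cite: MochizukiEtTh2009, §1 p.17].

LATTICE TWIST OF `Ẑ(1)²` — NOT the (B) section twist (cf. file 1, `SettingModelChiTwistedLattice.lean`, and abc-iut-L2-lead
R709).  abc-iut cell, K-L6 slice, row «KL6-CLOSURE-CERT F-2633», seat abc-iut-L6-t19 (gen 8).  Over files 1/1b/1c
(`PiTpLat`, `swapGfpLat`, `YNLat`, `ThetaSetting.modelLat`):

* `swapGfpLatCont` — the swap `t₁ ↔ t₂` of `Γ × Ẑ(1)²` as a continuous homomorphism, equivariant for `actLat`
  (`actLat_swapGfpLat`); **`swapPi p : PiTpLat p ≃ₜ* PiTpLat p`** — `swap ⋊ id`, a TOPOLOGICAL AUTOMORPHISM of `Π^tp_X`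
  (`Semidirect.mapCont` twice; an involution);
* **`inl_latt_mem_YNLat_two` / `swapPi_inl_latt_not_mem_YNLat_two`**: `w := ((1, (1, η(1))), 1) ∈ Π□_{Y_2}` (degree `0`,
  `y₂ + ℓ₂(t₁) = 0 + 0`) while `swapPi w = ((1, (η(1), 1)), 1) ∉ Π□_{Y_2}` (`ℓ₂(η(1)) = 1`);
* **`map_swapPi_gtpYdd_ne`**, **`exists_continuousMulEquiv_map_gtpYdd_ne`**: `Π^tp_Ÿ := GtpYdd` of `ThetaSetting.modelLat p`
  (`= Π□_{Y_2} ⊓ aug⁻¹ G_{J̈_1}`) is NOT stable under `swapPi` — the ROOT-LEVEL form of the failure of (H1)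
  `PiYddCharacteristic` at this inhabitant; file 3 restricts `swapPi` to the covering `X̲̲□` (whose defining clauses carry no
  lattice condition) to refute the universal closure of F-2633 proper.

HONEST LABEL: semi-synthetic model (consistency/independence evidence for OUR typed interface only); not the tempered
fundamental group of a curve; nothing of [EtTh] asserted; decides (H1)/F-2633 at no genuine instance; no side taken on
[IUTchIII] Cor. 3.12.  Class (b) construction file (def-bearing: `swapGfpLatCont`, `swapPi`; no instance, no notation, no
Prop-valued def).
-/

noncomputable section

namespace Literature.AnabelianGeometry.EtaleTheta.SettingModel

open Literature.AnabelianGeometry.SemiGraphs _root_.Topology _root_.Function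

variable (p : ℕ) [Fact p.Prime]

/-! ### The swap automorphism of `Π^tp_X` -/

/-- The swap `(γ, (t₁, t₂)) ↦ (γ, (t₂, t₁))` as a continuous homomorphism of `Γ × Ẑ(1)²`. [cite: MochizukiEtTh2009, §1 p.12] -/
def swapGfpLatCont : GfpLat →ₜ* GfpLat where
  toMonoidHom := swapGfpLat.toMonoidHom
  continuous_toFun := continuous_fst.prodMk ((continuous_swapLatt).comp continuous_snd)

/-- [cite: MochizukiEtTh2009, §1 p.12] -/
@[simp] theorem swapGfpLatCont_apply (x : GfpLat) : swapGfpLatCont x = (x.1, (x.2.2, x.2.1)) := rfl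

/-- `swap ∘ swap = id` on `Γ × Ẑ(1)²`. [cite: MochizukiEtTh2009, §1 p.12] -/
theorem swapGfpLatCont_swapGfpLatCont (x : GfpLat) : swapGfpLatCont (swapGfpLatCont x) = x := rfl

/-- The swap intertwines the action with itself. [cite: MochizukiEtTh2009, §1 p.12] -/
theorem swapGfpLatCont_actLat (σ : GQp p) (x : GfpLat) : swapGfpLatCont (actLat p σ x) = actLat p σ (swapGfpLatCont x) := rfl

/-- `swap ⋊ id` as a continuous endomorphism of `Π^tp_X`. [cite: MochizukiEtTh2009, §1 p.12] -/
def swapPiHom : PiTpLat p →ₜ* PiTpLat p :=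
  Semidirect.mapCont (isInducing_leftRightLat p) (isInducing_leftRightLat p) swapGfpLatCont (swapGfpLatCont_actLat p)

/-- [cite: MochizukiEtTh2009, §1 p.12] -/
@[simp] theorem swapPiHom_left (g : PiTpLat p) : (swapPiHom p g).left = swapGfpLatCont g.left := rfl

/-- [cite: MochizukiEtTh2009, §1 p.12] -/
@[simp] theorem swapPiHom_right (g : PiTpLat p) : (swapPiHom p g).right = g.right := rfl

/-- `swapPiHom` is an involution. [cite: MochizukiEtTh2009, §1 p.12] -/
theorem swapPiHom_swapPiHom (g : PiTpLat p) : swapPiHom p (swapPiHom p g) = g :=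
  SemidirectProduct.ext (by rw [swapPiHom_left, swapPiHom_left]; rfl) rfl

/-- **The swap automorphism `swap ⋊ id` of `Π^tp_X = (Γ × Ẑ(1)²) ⋊_χ G_{ℚ_p}`** (a topological group automorphism: the
diagonal cyclotomic action commutes with the swap). [cite: MochizukiEtTh2009, §1 p.12] -/
def swapPi : PiTpLat p ≃ₜ* PiTpLat p where
  toFun := swapPiHom p
  invFun := swapPiHom p
  left_inv := swapPiHom_swapPiHom p
  right_inv := swapPiHom_swapPiHom p
  map_mul' := map_mul (swapPiHom p)
  continuous_toFun := (swapPiHom p).continuous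
  continuous_invFun := (swapPiHom p).continuous

/-- [cite: MochizukiEtTh2009, §1 p.12] -/
theorem swapPi_apply (g : PiTpLat p) : swapPi p g = swapPiHom p g := rfl

/-- `swapPi` on `inl`. [cite: MochizukiEtTh2009, §1 p.12] -/
theorem swapPi_inl (x : GfpLat) :
    swapPi p (SemidirectProduct.inl x) = SemidirectProduct.inl (x.1, (x.2.2, x.2.1)) :=
  SemidirectProduct.ext rfl rfl

/-! ### `Π□_{Y_2}` is moved by the swap -/

/-- The test element `w := ((1, (1, η 1)), 1)`: trivial `Γ`- and Galois coordinates, lattice coordinate `(1, η(1))`.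
[cite: MochizukiEtTh2009, §1 p.17] -/
theorem inl_latt_mem_YNLat_two (N : ℕ+) :
    (SemidirectProduct.inl ((1 : Gfp), ((1 : ZH), ZHatLevel.eta 1)) : PiTpLat p) ∈ YNLat p N := by
  rw [mem_YNLat_iff, SemidirectProduct.left_inl, SemidirectProduct.right_inl, mem_AYLat_iff]
  refine ⟨⟨by rw [degLat_apply, map_one], ?_⟩, Subgroup.one_mem _⟩
  apply Multiplicative.toAdd.injective
  rw [toAdd_psiLat, map_one, toAdd_one]
  change (1 : Heis (ZMod N)).y + Multiplicative.toAdd (ZHatLevel.level N (1 : ZH)) = 0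
  rw [Heis.one_y, map_one, toAdd_one, add_zero]

/-- … whereas its swap `((1, (η 1, 1)), 1)` is NOT in `Π□_{Y_2}` (`ℓ₂(η 1) = 1 ≠ 0`). [cite: MochizukiEtTh2009, §1 p.17] -/
theorem swapPi_inl_latt_not_mem_YNLat_two :
    swapPi p (SemidirectProduct.inl ((1 : Gfp), ((1 : ZH), ZHatLevel.eta 1))) ∉ YNLat p (2 * 1) := by
  rw [swapPi_inl, mem_YNLat_iff, SemidirectProduct.left_inl, mem_AYLat_iff]
  rintro ⟨⟨-, h⟩, -⟩
  have h' := congrArg Multiplicative.toAdd h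
  rw [toAdd_psiLat, map_one, toAdd_one] at h'
  change (1 : Heis (ZMod (((2 : ℕ+) * 1 : ℕ+) : ℕ))).y +
    Multiplicative.toAdd (ZHatLevel.level ((2 : ℕ+) * 1) (ZHatLevel.eta 1)) = 0 at h'
  rw [Heis.one_y, zero_add, ZHatLevel.level_eta, toAdd_ofAdd, Int.cast_one] at h'
  exact absurd h' (by decide)

/-- **`Π□_{Y_2}` is not stable under the swap.** [cite: MochizukiEtTh2009, §1 p.17] -/
theorem map_swapPi_YNLat_two_ne :
    (YNLat p (2 * 1)).map (swapPi p).toMulEquiv.toMonoidHom ≠ YNLat p (2 * 1) := by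
  intro h
  have hw : swapPi p (SemidirectProduct.inl ((1 : Gfp), ((1 : ZH), ZHatLevel.eta 1))) ∈
      (YNLat p (2 * 1)).map (swapPi p).toMulEquiv.toMonoidHom :=
    ⟨_, inl_latt_mem_YNLat_two p (2 * 1), rfl⟩
  rw [h] at hw
  exact swapPi_inl_latt_not_mem_YNLat_two p hw

/-! ### `Π^tp_Ÿ` of `modelLat` is not characteristic -/

/-- `w ∈ Π^tp_Ÿ = Π□_{Y_2} ⊓ aug⁻¹ G_{J̈_1}` (its Galois coordinate is `1`). [cite: MochizukiEtTh2009, §1 p.17] -/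
theorem inl_latt_mem_gtpYdd :
    (SemidirectProduct.inl ((1 : Gfp), ((1 : ZH), ZHatLevel.eta 1)) : PiTpLat p) ∈ (ThetaSetting.modelLat p).GtpYdd := by
  change _ ∈ (ThetaSetting.modelLat p).GtpYN (2 * 1) ⊓ ((ThetaSetting.modelLat p).GJddN 1).comap _
  refine Subgroup.mem_inf.mpr ⟨inl_latt_mem_YNLat_two p (2 * 1), ?_⟩
  rw [Subgroup.mem_comap]
  change augLat p (SemidirectProduct.inl ((1 : Gfp), ((1 : ZH), ZHatLevel.eta 1))) ∈ (ThetaSetting.modelLat p).GJddN 1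
  rw [augLat_apply, SemidirectProduct.right_inl]
  exact Subgroup.one_mem _

/-- `swapPi w ∉ Π^tp_Ÿ`. [cite: MochizukiEtTh2009, §1 p.17] -/
theorem swapPi_inl_latt_not_mem_gtpYdd :
    swapPi p (SemidirectProduct.inl ((1 : Gfp), ((1 : ZH), ZHatLevel.eta 1))) ∉ (ThetaSetting.modelLat p).GtpYdd := by
  intro h
  have h1 : swapPi p (SemidirectProduct.inl ((1 : Gfp), ((1 : ZH), ZHatLevel.eta 1))) ∈
      (ThetaSetting.modelLat p).GtpYN (2 * 1) := (Subgroup.mem_inf.mp h).1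
  exact swapPi_inl_latt_not_mem_YNLat_two p h1

/-- **`Π^tp_Ÿ` of the lattice model is NOT stable under the swap automorphism of `Π^tp_X`.** [cite: MochizukiEtTh2009, §1 p.17] -/
theorem map_swapPi_gtpYdd_ne :
    (ThetaSetting.modelLat p).GtpYdd.map (swapPi p).toMulEquiv.toMonoidHom ≠ (ThetaSetting.modelLat p).GtpYdd := by
  intro h
  have hw : swapPi p (SemidirectProduct.inl ((1 : Gfp), ((1 : ZH), ZHatLevel.eta 1))) ∈
      (ThetaSetting.modelLat p).GtpYdd.map (swapPi p).toMulEquiv.toMonoidHom :=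
    ⟨_, inl_latt_mem_gtpYdd p, rfl⟩
  rw [h] at hw
  exact swapPi_inl_latt_not_mem_gtpYdd p hw

/-- **ROOT-LEVEL FAILURE OF (H1) at `modelLat`**: there is a topological automorphism of `Π^tp_X` not stabilising
`Π^tp_Ÿ` (the shape of `EtaleThetaDataOfSetting.PiYddCharacteristic` at `X̲̲ := X`). [cite: MochizukiEtTh2009, Cor 2.18 (i) p.57] -/
theorem exists_continuousMulEquiv_map_gtpYdd_ne :
    ∃ α : (ThetaSetting.modelLat p).PiTemp ≃ₜ* (ThetaSetting.modelLat p).PiTemp,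
      (ThetaSetting.modelLat p).GtpYdd.map α.toMulEquiv.toMonoidHom ≠ (ThetaSetting.modelLat p).GtpYdd :=
  ⟨swapPi p, map_swapPi_gtpYdd_ne p⟩

end Literature.AnabelianGeometry.EtaleTheta.SettingModel

end
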